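import Mathlib.Analysis.InnerProductSpace.Calculus
import Literature.Topology.FourManifolds.MMSWRasmussenFacts
import Literature.Topology.FourManifolds.RegularLevelSet
import Literature.Topology.FourManifolds.SmoothEmbeddingCriteria
import Summits.SmoothPoincare4.SmoothPoincare4.Theses.DottedCircleRasmussen
import Literature.Topology.FourManifolds.MMSWRasmussenGeneralPosition

/-!
# Helper `helper_friendsCarrier_meridianChart` of stub `stub_friendsCarrier` (line `mk_friends`, crux `DcrGap`)
(item stmt-SmoothPoincare4-16128, route route-SmoothPoincare4-DottedCircleRasmussen)

**The straightening chart of a model slice disc at an interior point** — the MERIDIAN CLAUSE of the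
carrier stub `stub_friendsCarrier` (clause `∃ p φ, ‖p‖ < 1 ∧ IsSmoothEmbedding φ ∧ IsOpen (range φ) ∧
φ 0 = f₁ p ∧ (∀ y, φ y ∉ D_k) ∧ (∀ y, φ y ∈ f₁(𝔻²) ↔ w(y) = 0) ∧ …`, in which the meridian `m` of the disc
`Δ₁ = f₁(𝔻²)` is then DEFINED as the fibre circle `m v = φ (0, 0, v)`), proved for every model slice
disc `f₁` (`MMSW.IsModelSliceDisc k K₁ f₁`) with `p = 0`, the centre of the disc:

* `helper_friendsCarrier_meridianChart` — there is a smooth embedding `φ : ℝ⁴ ↪ ℝ⁴` with open range,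
  `φ 0 = f₁ 0`, `range φ ∩ D_k = ∅`, and `φ y ∈ Δ₁ ↔ w(y) = 0` (`w = y₂ + i y₃`,
  `Literature.AlgebraicTopology.Homotopy.HopfFibration.wC`): in the chart `φ` the disc is the plane
  `{w = 0} = ℂ × {0}` and its normal circles are the circles `{z₀} × S¹_r`.

Proof (Guillemin–Pollack, *Differential Topology* (1974), Ch. 1 §3, local immersion theorem; Hirsch,
*Differential Topology* (1976), Ch. 1 Thm. 3.1).  Let `A = df₁(0) : ℝ² → ℝ⁴` (injective) and choose
`w₁, w₂` spanning a complement of its range (a basis of the orthogonal complement,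
`exists_complementary_pair`).  The map `F(y) = f₁(y₀, y₁) + y₂ w₁ + y₃ w₂` is smooth with invertible
differential `T = A ∘ π + S` at `0`, so it restricts to a partial diffeomorphism `G` near `0`
(`exists_openPartialHomeomorph_contDiffOn_symm`, the tree's packaged inverse function theorem with a
smooth inverse on the whole target).  Shrink to a ball `B(0, δ)` on which `F` stays `δ'`-close to
`f₁ 0` and off the closed `D_k`, where `δ'` is an injectivity radius of the compact embedded disc at
its centre (`exists_norm_lt_of_norm_sub_lt`: `‖f₁ x - f₁ 0‖ < δ' ⇒ ‖x‖ < ε`, `B(0, ε) ⊆ G.source`); then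
`F(u) ∈ Δ₁` forces `u` to be a point `(x, 0, 0)` of the straightened disc, by injectivity of `G`.
Finally `φ = G ∘ univBall 0 δ` (Mathlib's radial diffeomorphism `ℝ⁴ ≅ B(0, δ)`, which preserves the
plane `{w = 0}`) is a globally defined partial diffeomorphism, hence a smooth embedding with open range
(`isSmoothEmbedding_of_openPartialHomeomorph`).  No definitions, no named facts, no `sorry`.
-/

-- the prescribed namespace `Summit.<P>.<Sub>.…` duplicates `SmoothPoincare4` (P = Sub)
set_option linter.dupNamespace false
set_option linter.style.longLine false

noncomputable section

open scoped Manifold ContDiff Topology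
open Function Set Metric OpenPartialHomeomorph
open Literature.Topology.FourManifolds Literature.Topology.FourManifolds.MMSW
open Literature.AlgebraicTopology.Homotopy.HopfFibration (wC)

namespace Summit.SmoothPoincare4.SmoothPoincare4.Theorems.DcrGap.MkFriends

/-! ## Linear algebra: a complementary pair for an injective `ℝ² → ℝ⁴` -/

/-- **A complementary pair.**  For an injective linear map `A : ℝ² → ℝ⁴` there are `w₁, w₂ ∈ ℝ⁴` such
that `(A e₀, A e₁, w₁, w₂)` is a basis: `A a + s w₁ + t w₂ = 0` forces `a = 0` and `s = t = 0` (take a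
basis of the orthogonal complement of the range, which meets the range in `0`). [folklore] -/
theorem exists_complementary_pair (A : EuclideanSpace ℝ (Fin 2) →L[ℝ] EuclideanSpace ℝ (Fin 4))
    (hA : Injective A) :
    ∃ w₁ w₂ : EuclideanSpace ℝ (Fin 4), ∀ (a : EuclideanSpace ℝ (Fin 2)) (s t : ℝ),
      A a + s • w₁ + t • w₂ = 0 → a = 0 ∧ s = 0 ∧ t = 0 := by
  have hr : Module.finrank ℝ
      (LinearMap.range (A : EuclideanSpace ℝ (Fin 2) →ₗ[ℝ] EuclideanSpace ℝ (Fin 4))) = 2 := by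
    rw [LinearMap.finrank_range_of_inj hA, finrank_euclideanSpace_fin]
  have h2 : Module.finrank ℝ
      (LinearMap.range (A : EuclideanSpace ℝ (Fin 2) →ₗ[ℝ] EuclideanSpace ℝ (Fin 4)))ᗮ = 2 := by
    have := Submodule.finrank_add_finrank_orthogonal
      (LinearMap.range (A : EuclideanSpace ℝ (Fin 2) →ₗ[ℝ] EuclideanSpace ℝ (Fin 4)))
    rw [hr, finrank_euclideanSpace_fin] at this
    omega
  set W := (LinearMap.range (A : EuclideanSpace ℝ (Fin 2) →ₗ[ℝ] EuclideanSpace ℝ (Fin 4)))ᗮ with hW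
  set b := Module.finBasisOfFinrankEq ℝ W h2 with hb
  have hli : LinearIndependent ℝ (W.subtype ∘ b) :=
    b.linearIndependent.map' W.subtype W.ker_subtype
  refine ⟨b 0, b 1, fun a s t h => ?_⟩
  have hmemW : s • ((b 0 : W) : EuclideanSpace ℝ (Fin 4)) + t • ((b 1 : W) : EuclideanSpace ℝ (Fin 4))
      ∈ W := W.add_mem (W.smul_mem s (b 0).2) (W.smul_mem t (b 1).2)
  have hmemR : A a ∈ LinearMap.range (A : EuclideanSpace ℝ (Fin 2) →ₗ[ℝ] EuclideanSpace ℝ (Fin 4)) :=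
    LinearMap.mem_range_self _ a
  have hAa : A a = -(s • ((b 0 : W) : EuclideanSpace ℝ (Fin 4)) +
      t • ((b 1 : W) : EuclideanSpace ℝ (Fin 4))) := by
    rw [eq_neg_iff_add_eq_zero, ← h]
    abel
  have hzero : A a = 0 := by
    have hmem : A a ∈ LinearMap.range (A : EuclideanSpace ℝ (Fin 2) →ₗ[ℝ] EuclideanSpace ℝ (Fin 4))
        ⊓ W := Submodule.mem_inf.2 ⟨hmemR, by rw [hAa]; exact W.neg_mem hmemW⟩
    rw [hW, Submodule.inf_orthogonal_eq_bot, Submodule.mem_bot] at hmem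
    exact hmem
  have ha : a = 0 := hA (by rw [hzero, map_zero])
  have hst : s • ((b 0 : W) : EuclideanSpace ℝ (Fin 4)) +
      t • ((b 1 : W) : EuclideanSpace ℝ (Fin 4)) = 0 := by
    have := h
    rwa [hzero, zero_add] at this
  have hg := (Fintype.linearIndependent_iff.1 hli) ![s, t] (by simpa [Fin.sum_univ_two] using hst)
  exact ⟨ha, by simpa using hg 0, by simpa using hg 1⟩

/-! ## The injectivity radius of a compact embedded disc at its centre -/

/-- **Injectivity radius at the centre.**  If `f` is continuous and injective on the closed unit disc
`𝔻²`, then for every `ε > 0` there is `δ' > 0` with `‖f x - f 0‖ < δ' ⇒ ‖x‖ < ε` on `𝔻²` (the inverse of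
the embedding of the compact disc is continuous at `f 0`: minimise `‖f x - f 0‖` over the compact
`𝔻² ∩ {ε ≤ ‖x‖}`). [folklore] -/
theorem exists_norm_lt_of_norm_sub_lt {f : EuclideanSpace ℝ (Fin 2) → EuclideanSpace ℝ (Fin 4)}
    (hf : Continuous f) (hinj : InjOn f (closedBall (0 : EuclideanSpace ℝ (Fin 2)) 1)) {ε : ℝ}
    (hε : 0 < ε) :
    ∃ δ' : ℝ, 0 < δ' ∧ ∀ x ∈ closedBall (0 : EuclideanSpace ℝ (Fin 2)) 1, ‖f x - f 0‖ < δ' → ‖x‖ < ε := by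
  set S : Set (EuclideanSpace ℝ (Fin 2)) := closedBall (0 : EuclideanSpace ℝ (Fin 2)) 1 ∩ {x | ε ≤ ‖x‖}
    with hS
  have hSc : IsCompact S :=
    (isCompact_closedBall _ _).inter_right (isClosed_le continuous_const continuous_norm)
  rcases S.eq_empty_or_nonempty with hSe | hSne
  · refine ⟨1, one_pos, fun x hx _ => ?_⟩
    by_contra hlt
    have : x ∈ S := ⟨hx, not_lt.1 hlt⟩
    rw [hSe] at this
    exact this
  · have hcont : ContinuousOn (fun x => ‖f x - f 0‖) S := by fun_prop
    obtain ⟨x₀, hx₀S, hmin⟩ := hSc.exists_isMinOn hSne hcont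
    have hx₀ne : x₀ ≠ 0 := by
      intro h0
      have := hx₀S.2
      rw [mem_setOf_eq, h0, norm_zero] at this
      exact absurd this (not_le.2 hε)
    have hpos : 0 < ‖f x₀ - f 0‖ := by
      rw [norm_pos_iff, sub_ne_zero]
      intro hEq
      exact hx₀ne (hinj hx₀S.1 (mem_closedBall_self zero_le_one) hEq)
    refine ⟨‖f x₀ - f 0‖, hpos, fun x hx hlt => ?_⟩
    by_contra hge
    have hxS : x ∈ S := ⟨hx, not_lt.1 hge⟩
    exact absurd (isMinOn_iff.1 hmin x hxS) (not_le.2 hlt)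

/-! ## Coordinates -/

/-- `‖(y₀, y₁)‖ ≤ ‖y‖`. [folklore] -/
theorem norm_fstTwo_le (y : EuclideanSpace ℝ (Fin 4)) :
    ‖(!₂[y 0, y 1] : EuclideanSpace ℝ (Fin 2))‖ ≤ ‖y‖ := by
  rw [EuclideanSpace.norm_eq, EuclideanSpace.norm_eq]
  apply Real.sqrt_le_sqrt
  simp only [Fin.sum_univ_four, Fin.sum_univ_two, Real.norm_eq_abs, sq_abs]
  simp
  nlinarith [sq_nonneg (y 2), sq_nonneg (y 3)]

/-- `‖(x₀, x₁, 0, 0)‖ = ‖x‖`. [folklore] -/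
theorem norm_padTwo_eq (x : EuclideanSpace ℝ (Fin 2)) :
    ‖(!₂[x 0, x 1, 0, 0] : EuclideanSpace ℝ (Fin 4))‖ = ‖x‖ := by
  rw [EuclideanSpace.norm_eq, EuclideanSpace.norm_eq]
  simp [Fin.sum_univ_four, Fin.sum_univ_two]

/-- Mathlib's radial diffeomorphism `univBall 0 δ : ℝ⁴ ≅ B(0, δ)` is a positive rescaling of each
vector (so it preserves every linear subspace, in particular the plane `{w = 0}`). [folklore] -/
theorem exists_univBall_eq_smul {δ : ℝ} (hδ : 0 < δ) (y : EuclideanSpace ℝ (Fin 4)) :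
    ∃ c : ℝ, 0 < c ∧ univBall (0 : EuclideanSpace ℝ (Fin 4)) δ y = c • y :=
  ⟨δ * (√(1 + ‖y‖ ^ 2))⁻¹, by positivity, by simp [univBall, hδ, univUnitBall_apply, smul_smul]⟩

/-- `w(y) = y₂ + i y₃` vanishes iff `y₂ = y₃ = 0`. [folklore] -/
theorem wC_eq_zero_iff (y : EuclideanSpace ℝ (Fin 4)) : wC y = 0 ↔ y 2 = 0 ∧ y 3 = 0 := by
  simp [Complex.ext_iff]

/-! ## The straightening chart -/

/-- **Helper `helper_friendsCarrier_meridianChart`** (registered on the crux item; the meridian clause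
of stub `stub_friendsCarrier` with `p = 0`).  For every model slice disc `Δ₁ = f₁(𝔻²)` of a model knot
`K₁ ⊂ ∂D_k` (`MMSW.IsModelSliceDisc k K₁ f₁`) there is a STRAIGHTENING CHART of `Δ₁` at its centre
`f₁ 0`: a smooth embedding `φ : ℝ⁴ ↪ ℝ⁴` with open range, `φ 0 = f₁ 0`, whose range misses the model
handlebody `D_k`, and which carries the plane `{w = 0}` exactly onto `range φ ∩ Δ₁`:
`φ y ∈ Δ₁ ↔ w(y) = 0`.  (The meridian of `Δ₁` in the stub is then the fibre circle
`m v = φ (0, 0, v)`, `v ∈ S¹`.)  Local immersion theorem at an interior point of the embedded disc,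
with the normal plane spanned by a complementary pair of `df₁(0)`.
[cite: HirschDT1976, Ch. 1 §3, Thm. 3.1] -/
theorem helper_friendsCarrier_meridianChart : ∀ (k : ℕ) (K₁ : (Metric.sphere (0 : EuclideanSpace ℝ (Fin 2)) 1) → EuclideanSpace ℝ (Fin 4)) (f₁ : EuclideanSpace ℝ (Fin 2) → EuclideanSpace ℝ (Fin 4)), Literature.Topology.FourManifolds.MMSW.IsModelSliceDisc k K₁ f₁ → ∃ (p : EuclideanSpace ℝ (Fin 2)) (φ : EuclideanSpace ℝ (Fin 4) → EuclideanSpace ℝ (Fin 4)), ‖p‖ < 1 ∧ Manifold.IsSmoothEmbedding (𝓡 4) (𝓡 4) ((⊤ : ℕ∞) : WithTop ℕ∞) φ ∧ IsOpen (Set.range φ) ∧ φ 0 = f₁ p ∧ (∀ y, φ y ∉ Literature.Topology.FourManifolds.MMSW.modelHandlebody k) ∧ (∀ y, φ y ∈ f₁ '' Metric.closedBall (0 : EuclideanSpace ℝ (Fin 2)) 1 ↔ Literature.AlgebraicTopology.Homotopy.HopfFibration.wC y = 0) := by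
  intro k K₁ f₁ h
  obtain ⟨hf, hinj, hd, hout, -⟩ := h
  have hfs : ContDiff ℝ ∞ f₁ := contMDiff_iff_contDiff.1 hf
  -- the differential at the centre is injective
  set A : EuclideanSpace ℝ (Fin 2) →L[ℝ] EuclideanSpace ℝ (Fin 4) := fderiv ℝ f₁ 0 with hA
  have hAinj : Injective A := by
    have := hd 0 (mem_closedBall_self zero_le_one)
    rwa [mfderiv_eq_fderiv] at this
  obtain ⟨w₁, w₂, hw⟩ := exists_complementary_pair A hAinj
  -- the coordinate projection `π y = (y₀, y₁)` as a continuous linear map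
  have hlin : IsLinearMap ℝ (fun y : EuclideanSpace ℝ (Fin 4) => (!₂[y 0, y 1] : EuclideanSpace ℝ (Fin 2))) :=
    ⟨fun x y => by ext i; fin_cases i <;> simp, fun c x => by ext i; fin_cases i <;> simp⟩
  set π : EuclideanSpace ℝ (Fin 4) →L[ℝ] EuclideanSpace ℝ (Fin 2) :=
    LinearMap.toContinuousLinearMap (hlin.mk' _) with hπdef
  have hπ : ∀ y, π y = !₂[y 0, y 1] := fun y => rfl
  have hπ0 : π 0 = 0 := map_zero π
  -- the linear correction `S y = y₂ w₁ + y₃ w₂`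
  set S : EuclideanSpace ℝ (Fin 4) →L[ℝ] EuclideanSpace ℝ (Fin 4) :=
    (EuclideanSpace.proj (2 : Fin 4) : EuclideanSpace ℝ (Fin 4) →L[ℝ] ℝ).smulRight w₁ +
      (EuclideanSpace.proj (3 : Fin 4) : EuclideanSpace ℝ (Fin 4) →L[ℝ] ℝ).smulRight w₂ with hSdef
  have hS : ∀ y, S y = y 2 • w₁ + y 3 • w₂ := fun y => by simp [hSdef]
  -- the straightening map `F y = f₁ (π y) + S y`
  set F : EuclideanSpace ℝ (Fin 4) → EuclideanSpace ℝ (Fin 4) := fun y => f₁ (π y) + S y with hFdef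
  have hFs : ContDiff ℝ ∞ F := (hfs.comp π.contDiff).add S.contDiff
  have hF0 : F 0 = f₁ 0 := by
    show f₁ (π 0) + S 0 = f₁ 0
    rw [hπ0, map_zero, add_zero]
  -- its differential at `0` is the automorphism `T v = A (π v) + S v`
  have hderiv : HasFDerivAt F (A.comp π + S) 0 := by
    have h1 : HasFDerivAt f₁ A (π 0) := by
      rw [hπ0]
      exact ((hfs.differentiable (by simp)).differentiableAt).hasFDerivAt
    exact (h1.comp (0 : EuclideanSpace ℝ (Fin 4)) π.hasFDerivAt).add S.hasFDerivAt
  have hTinj : Injective (A.comp π + S) := by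
    intro u v huv
    rw [← sub_eq_zero] at huv ⊢
    rw [← map_sub] at huv
    have h0 : A (π (u - v)) + (u - v) 2 • w₁ + (u - v) 3 • w₂ = 0 := by
      have : (A.comp π + S) (u - v) = A (π (u - v)) + ((u - v) 2 • w₁ + (u - v) 3 • w₂) := by
        rw [add_apply, ContinuousLinearMap.comp_apply, hS]
      rw [this, ← add_assoc] at huv
      exact huv
    obtain ⟨hπd, h2, h3⟩ := hw (π (u - v)) ((u - v) 2) ((u - v) 3) h0
    have e0 : (u - v) 0 = 0 := by
      have := congrArg (fun z : EuclideanSpace ℝ (Fin 2) => z 0) hπd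
      simpa [hπ] using this
    have e1 : (u - v) 1 = 0 := by
      have := congrArg (fun z : EuclideanSpace ℝ (Fin 2) => z 1) hπd
      simpa [hπ] using this
    ext i
    fin_cases i
    · simpa using e0
    · simpa using e1
    · simpa using h2
    · simpa using h3
  have hTbij : Bijective (A.comp π + S) :=
    ⟨hTinj, (LinearMap.injective_iff_surjective
      (f := ((A.comp π + S : EuclideanSpace ℝ (Fin 4) →L[ℝ] EuclideanSpace ℝ (Fin 4)) :
        EuclideanSpace ℝ (Fin 4) →ₗ[ℝ] EuclideanSpace ℝ (Fin 4)))).1 hTinj⟩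
  set T : EuclideanSpace ℝ (Fin 4) ≃L[ℝ] EuclideanSpace ℝ (Fin 4) :=
    (LinearEquiv.ofBijective ((A.comp π + S : EuclideanSpace ℝ (Fin 4) →L[ℝ] EuclideanSpace ℝ (Fin 4)) :
      EuclideanSpace ℝ (Fin 4) →ₗ[ℝ] EuclideanSpace ℝ (Fin 4)) hTbij).toContinuousLinearEquiv with hTdef
  have hTcoe : (T : EuclideanSpace ℝ (Fin 4) →L[ℝ] EuclideanSpace ℝ (Fin 4)) = A.comp π + S := by
    ext v
    rfl
  -- inverse function theorem, packaged with a smooth inverse on the whole target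
  obtain ⟨G, hGF, h0G, -, hGs, hGs'⟩ := exists_openPartialHomeomorph_contDiffOn_symm isOpen_univ
    (mem_univ (0 : EuclideanSpace ℝ (Fin 4))) (m := ∞) (by exact_mod_cast le_top) hFs.contDiffOn T
    (by rw [hTcoe]; exact hderiv)
  -- a ball in the source
  obtain ⟨ε, hε, hεG⟩ := Metric.isOpen_iff.1 G.open_source 0 h0G
  -- injectivity radius of the compact embedded disc at its centre
  obtain ⟨δ', hδ', hδ'P⟩ := exists_norm_lt_of_norm_sub_lt hfs.continuous hinj hε
  -- `D_k` is closed and misses `f₁ 0`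
  have hout0 : f₁ 0 ∉ modelHandlebody k := hout 0 (by simp)
  have hDcl : IsClosed (modelHandlebody k) := by
    have : modelHandlebody k =
        {x : EuclideanSpace ℝ (Fin 4) | ∀ j : Fin k, 1 ≤ holeTerm k j x} ∩ levelFun k ⁻¹' Iic 1 := rfl
    rw [this]
    exact (continuousOn_levelFun one_pos).preimage_isClosed_of_isClosed (isClosed_guard 1) isClosed_Iic
  obtain ⟨δ₂, hδ₂, hδ₂D⟩ := Metric.isOpen_iff.1 hDcl.isOpen_compl (f₁ 0) hout0
  -- continuity of `F` at `0`
  obtain ⟨δ₁, hδ₁, hδ₁F⟩ := Metric.continuousAt_iff.1 (hFs.continuous.continuousAt (x := 0))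
    (min δ' δ₂) (lt_min hδ' hδ₂)
  -- the radius of the chart
  set δ : ℝ := min (min ε 1) δ₁ with hδdef
  have hδ : 0 < δ := lt_min (lt_min hε one_pos) hδ₁
  have hδε : δ ≤ ε := (min_le_left _ _).trans (min_le_left _ _)
  have hδ1 : δ ≤ 1 := (min_le_left _ _).trans (min_le_right _ _)
  have hδδ₁ : δ ≤ δ₁ := min_le_right _ _
  have hballG : ball (0 : EuclideanSpace ℝ (Fin 4)) δ ⊆ G.source := (ball_subset_ball hδε).trans hεG
  -- points of the small ball have image `δ'`-close to `f₁ 0` and off `D_k`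
  have hFclose : ∀ u : EuclideanSpace ℝ (Fin 4), ‖u‖ < δ →
      ‖F u - F 0‖ < δ' ∧ F u ∉ modelHandlebody k := by
    intro u hu
    have hdist : dist (F u) (F 0) < min δ' δ₂ :=
      hδ₁F (by rw [dist_zero_right]; exact hu.trans_le hδδ₁)
    rw [dist_eq_norm] at hdist
    refine ⟨hdist.trans_le (min_le_left _ _), fun hmem => ?_⟩
    have hball : F u ∈ ball (f₁ 0) δ₂ := by
      rw [mem_ball, dist_eq_norm, ← hF0]
      exact hdist.trans_le (min_le_right _ _)
    exact hδ₂D hball hmem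
  -- the chart: shrink `ℝ⁴` radially onto the ball, then straighten
  set Φ : OpenPartialHomeomorph (EuclideanSpace ℝ (Fin 4)) (EuclideanSpace ℝ (Fin 4)) :=
    (univBall (0 : EuclideanSpace ℝ (Fin 4)) δ).trans G with hΦdef
  have hu : ∀ y : EuclideanSpace ℝ (Fin 4),
      univBall (0 : EuclideanSpace ℝ (Fin 4)) δ y ∈ ball (0 : EuclideanSpace ℝ (Fin 4)) δ := fun y => by
    rw [← univBall_target (0 : EuclideanSpace ℝ (Fin 4)) hδ]
    exact (univBall (0 : EuclideanSpace ℝ (Fin 4)) δ).map_source (by simp)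
  have hsrc : Φ.source = univ := by
    rw [hΦdef, trans_source, univBall_source, univ_inter, eq_univ_iff_forall]
    exact fun y => hballG (hu y)
  have hΦapply : ∀ y, Φ y = F (univBall (0 : EuclideanSpace ℝ (Fin 4)) δ y) := fun y => by
    rw [hΦdef, coe_trans, comp_apply, hGF]
  have hΦs : ContMDiffOn (𝓡 4) (𝓡 4) ∞ Φ Φ.source := by
    rw [contMDiffOn_iff_contDiffOn, hsrc, hΦdef, coe_trans]
    exact hGs.comp contDiff_univBall.contDiffOn fun y _ => hballG (hu y)
  have hΦs' : ContMDiffOn (𝓡 4) (𝓡 4) ∞ Φ.symm Φ.target := by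
    rw [contMDiffOn_iff_contDiffOn, hΦdef, trans_symm_eq_symm_trans_symm, coe_trans, trans_target]
    refine (contDiffOn_univBall_symm (c := (0 : EuclideanSpace ℝ (Fin 4))) (r := δ)).comp
      (hGs'.mono inter_subset_left) ?_
    intro z hz
    have := hz.2
    rw [mem_preimage, univBall_target (0 : EuclideanSpace ℝ (Fin 4)) hδ] at this
    exact this
  have hemb : Manifold.IsSmoothEmbedding (𝓡 4) (𝓡 4) ∞ Φ :=
    isSmoothEmbedding_of_openPartialHomeomorph Φ hsrc hΦs hΦs'
      (ContinuousLinearEquiv.refl ℝ (EuclideanSpace ℝ (Fin 4)))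
  refine ⟨0, Φ, by simp, hemb, ?_, ?_, ?_, ?_⟩
  · -- open range
    rw [← image_univ, ← hsrc, image_source_eq_target]
    exact Φ.open_target
  · -- centre
    rw [hΦapply, univBall_apply_zero, hF0]
  · -- off `D_k`
    intro y
    rw [hΦapply]
    exact (hFclose _ (mem_ball_zero_iff.1 (hu y))).2
  · -- the straightened disc
    intro y
    obtain ⟨c, hc, hcy⟩ := exists_univBall_eq_smul hδ y
    rw [hΦapply, wC_eq_zero_iff, hcy]
    have hcu : ‖c • y‖ < δ := by
      rw [← hcy]
      exact mem_ball_zero_iff.1 (hu y)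
    constructor
    · rintro ⟨x, hx, hxF⟩
      -- `f₁ x = F (c • y)` is `δ'`-close to `f₁ 0`, so `‖x‖ < ε` and the padded `x` lies in the source
      have hclose := (hFclose _ hcu).1
      rw [← hxF, hF0] at hclose
      have hxε : ‖x‖ < ε := hδ'P x hx hclose
      have heG : (!₂[x 0, x 1, 0, 0] : EuclideanSpace ℝ (Fin 4)) ∈ G.source :=
        hεG (by rw [mem_ball_zero_iff, norm_padTwo_eq]; exact hxε)
      have hπe : π (!₂[x 0, x 1, 0, 0]) = x := by
        rw [hπ]
        ext i
        fin_cases i <;> simp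
      have hFe : F (!₂[x 0, x 1, 0, 0]) = f₁ x := by
        show f₁ (π (!₂[x 0, x 1, 0, 0])) + S (!₂[x 0, x 1, 0, 0]) = f₁ x
        rw [hπe, hS]
        simp
      have hEq : G (c • y) = G (!₂[x 0, x 1, 0, 0]) := by
        rw [hGF, hFe, hxF]
      have huy := G.injOn (hballG (mem_ball_zero_iff.2 hcu)) heG hEq
      have e2 : (c • y) 2 = 0 := by rw [huy]; simp
      have e3 : (c • y) 3 = 0 := by rw [huy]; simp
      simp only [PiLp.smul_apply, smul_eq_mul, mul_eq_zero, hc.ne', false_or] at e2 e3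
      exact ⟨e2, e3⟩
    · rintro ⟨h2, h3⟩
      refine ⟨π (c • y), ?_, ?_⟩
      · rw [mem_closedBall_zero_iff]
        calc ‖π (c • y)‖ ≤ ‖c • y‖ := by rw [hπ]; exact norm_fstTwo_le _
          _ ≤ 1 := hcu.le.trans hδ1
      · have hS0 : S (c • y) = 0 := by
          rw [hS]
          simp [h2, h3]
        show f₁ (π (c • y)) = f₁ (π (c • y)) + S (c • y)
        rw [hS0, add_zero]

end Summit.SmoothPoincare4.SmoothPoincare4.Theorems.DcrGap.MkFriends

end
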